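import Literature.NumberTheory.Sieve.HardyLittlewoodChowlaMomentsPrep
import Literature.NumberTheory.Sieve.HardyLittlewoodChowlaTuples
import HarnessLib

/-!
# Hardy–Littlewood–Chowla on average (Lichtman–Teräväinen 2022): moments of prime-tuple sums, II

Topic `Literature/NumberTheory/Sieve`, companion of `HardyLittlewoodChowla.lean` (the named facts
`lichtmanTeravainen2022_hlc_avg(_liouville)` = J. D. Lichtman, J. Teräväinen, *On the
Hardy–Littlewood–Chowla conjecture on average*, Forum Math. Sigma 10 (2022) e57, arXiv:2111.08912
[LichtmanTeravainen2022], Theorem 1.2 (i)).  Everything in this file is PROVED; it introduces no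
definition and no named fact.

**Proposition 2.7 of the paper** (held copy `paper:arxiv-2111.08912`, §2.2): "Let `ℓ ≥ 1`, `k ≥ 2` be
fixed, and let `a₁, …, a_ℓ` be distinct fixed integers. For `X ≥ H ≥ 2` and `|g(n)| ≤ 1`, we have
`M_{2k} := ∫₀^X ∫₀¹ |∑_{x ≤ n ≤ x+H} g(n) e(αn) ∏_{j=1}^ℓ Λ(n+a_j)|^{2k} dα dx
≪ X (H^{2k-1} + H^k (log X)^{kℓ} + H (log X)^{(2k-1)ℓ})`. In particular if `H ≥ (log X)^{ℓk/(k-1)}`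
then `M_{2k} ≪ X H^{2k-1}`", in the discrete setting of `HardyLittlewoodChowlaFourier.lean` and in
the crude uniform form delivered by the tree's upper-bound sieve (a harmless extra factor
`(log log X)^{2kℓ}`, the singular series being absorbed rather than averaged):

* `LichtmanTeravainen2022.Liouville.moment_bound` (sub-namespace `Liouville`: the route to the
  Liouville fact; the companion file `HardyLittlewoodChowlaMomentBound.lean` of the Möbius route
  proves a variant `LichtmanTeravainen2022.moment_bound` with the exponent `j` chosen inside and the
  weight supported on `[1, X]`) — for the weight
  `w(n) = 𝟙_{[2H, X]}(n) g(n) ∏_{a ∈ A} Λ(n + a)` with `|g| ≤ 1` (in the paper `g(n) = ∏ᵢ μ(n + hᵢ)`,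
  resp. `∏ᵢ λ(n + hᵢ)`; `ℓ = #A ≥ 1`), `j ≥ 2` and `(log X)^{ℓ j} ≤ (2H)^{j-1}` (i.e.
  `2H ≥ (log X)^{ℓ j/(j-1)}`), `4H + max A ≤ X`, `X ≥ X₀(A, j)`:
  `∫₀¹ ∑_{k ≤ X+2H} |∑_{n ∈ (k-2H, k]} w(n) e(-nα)|^{2j} dα ≤ C(A, j) X (log log X)^{2jℓ} H^{2j-1}`.

Proof (the paper's, §2.2): expand the moment by orthogonality
(`integral_norm_pow_le_sum_balanced`), pass to a base point and an offset pattern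
(`sum_windows_le_line`), bound the correlation of `Λ` along the `2jℓ` shifts by the sieve with a
factor `log X` per coincidence (`sum_prod_vonMangoldt_le_of_card_image`), bound the number of coincidences through
the leaders of the pattern (`card_mul_card_leaders_le`, the paper's "`|𝓘| ≥ ⌈m/ℓ⌉`") and count the
patterns with a given number of leaders (`card_pinned_balanced_le`, the paper's
"`≪ H^{2k-2-⌈m/ℓ⌉+𝟙_{m>(k-1)ℓ}}`"); the hypothesis `(log X)^{ℓ j} ≤ (2H)^{j-1}` makes every term
`≪ H^{2j-2}`.

## References

* J. D. Lichtman, J. Teräväinen, Forum Math. Sigma 10 (2022) e57, arXiv:2111.08912, §2.2,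
  Proposition 2.7 and its proof. [cite: LichtmanTeravainen2022, Proposition 2.7]
-/

open Finset MeasureTheory
open scoped FourierTransform ComplexConjugate ArithmeticFunction.vonMangoldt

namespace Literature.NumberTheory.Sieve.LichtmanTeravainen2022.Liouville

open Literature.NumberTheory.Sieve.Lichtman2020 (continuous_fourierChar_mul norm_fourierChar)

/-! ### Small lemmas -/

/-- Splitting a product over `Fin (j + j)` of an appended family. [folklore] -/
theorem prod_append {M : Type*} [CommMonoid M] {j : ℕ} (e e' : Fin j → ℕ) (F : ℕ → M) :
    ∏ i : Fin (j + j), F (Fin.append e e' i) = (∏ i, F (e i)) * ∏ i, F (e' i) := by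
  rw [Fin.prod_univ_add]
  simp only [Fin.append_left, Fin.append_right]

/-- Splitting the signed sum over `Fin (j + j)` of an appended family. [folklore] -/
theorem sum_sign_append {j : ℕ} (e e' : Fin j → ℤ) :
    ∑ i : Fin (j + j), (if (i : ℕ) < j then (1 : ℤ) else -1) * Fin.append e e' i =
      (∑ i, e i) - ∑ i, e' i := by
  rw [Fin.sum_univ_add]
  simp only [Fin.append_left, Fin.append_right, Fin.val_castAdd, Fin.is_lt, if_true, one_mul,
    Fin.val_natAdd]
  have : ∀ i : Fin j, ¬ (j + (i : ℕ) < j) := fun i => by omega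
  simp only [this, if_false, neg_one_mul, Finset.sum_neg_distrib]
  ring

/-- `Fin.append` (with casts) is injective in the pair. [folklore] -/
theorem append_cast_injective {j : ℕ} {e₁ e₁' e₂ e₂' : Fin j → ℕ}
    (h : Fin.append (fun i => (e₁ i : ℤ)) (fun i => (e₁' i : ℤ)) =
      Fin.append (fun i => (e₂ i : ℤ)) (fun i => (e₂' i : ℤ))) : e₁ = e₂ ∧ e₁' = e₂' := by
  constructor
  · funext i
    have := congrFun h (Fin.castAdd j i)
    simp only [Fin.append_left] at this
    exact_mod_cast this
  · funext i
    have := congrFun h (Fin.natAdd j i)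
    simp only [Fin.append_right] at this
    exact_mod_cast this

/-! ### Proposition 2.7 -/

set_option maxHeartbeats 800000 in
/-- **Lichtman–Teräväinen 2022, Proposition 2.7 (moments of short exponential sums over prime
tuples), discrete crude form.**  Let `A` (the von Mangoldt shifts, `ℓ = #A ≥ 1`) be a finite set of
natural numbers and `j ≥ 2`.  There are `C, X₀ ≥ 0` (depending on `A, j` only) such that for every
`1`-bounded `g : ℕ → ℂ` (printed: "`|g(n)| ≤ 1`"; in the application `g(n) = ∏ᵢ μ(n + hᵢ)` or
`∏ᵢ λ(n + hᵢ)`), all `X ≥ X₀` and `H ≥ 1` with `(log X)^{ℓ j} ≤ (2H)^{j-1}` and `4H + max A ≤ X`,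
the weight `w(n) = 𝟙_{2H ≤ n ≤ X} g(n) ∏_{a ∈ A} Λ(n+a)` satisfies
`∫₀¹ ∑_{k=1}^{X+2H} |∑_{n ∈ (k-2H, k]} w(n) e(-nα)|^{2j} dα ≤ C X (log log X)^{2jℓ} H^{2j-1}`
(printed: "if `H ≥ (log X)^{ℓk/(k-1)}` then `M_{2k} ≪ X H^{2k-1}`"; here with the explicit extra factor
`(log log X)^{2jℓ}` of the crude sieve bound, immaterial downstream).
[cite: LichtmanTeravainen2022, Proposition 2.7] -/
theorem moment_bound (A : Finset ℕ) (hA : A.Nonempty) (j : ℕ) (hj : 2 ≤ j) :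
    ∃ (C : ℝ) (X₀ : ℕ), 0 ≤ C ∧ ∀ (g : ℕ → ℂ), (∀ n, ‖g n‖ ≤ 1) → ∀ X : ℕ, X₀ ≤ X → ∀ H : ℕ, 1 ≤ H →
      Real.log X ^ (#A * j) ≤ ((2 * H : ℕ) : ℝ) ^ (j - 1) → 4 * H + A.sup id ≤ X →
      ∫ α in (0 : ℝ)..1, ∑ k ∈ Icc 1 (X + 2 * H),
          ‖∑ n ∈ Ioc (k - 2 * H) k,
            (if 2 * H ≤ n ∧ n ≤ X then ((∏ a ∈ A, Λ (n + a) : ℝ) : ℂ) * g n else 0) *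
              (𝐞 (-((n : ℝ) * α)) : ℂ)‖ ^ (2 * j) ≤
        C * X * Real.log (Real.log X) ^ ((j + j) * #A) * (H : ℝ) ^ (2 * j - 1) := by
  classical
  -- parameters: `ℓ = #A`, `m = j + j`, `M = (j + j) * #A`
  have hℓ1 : 1 ≤ #A := Finset.card_pos.2 hA
  have hj1 : 1 ≤ j := by omega
  -- the sign vector, the pinned index, the distance
  set sgn : Fin (j + j) → ℤ := fun i => if (i : ℕ) < j then 1 else -1 with hsgn
  have hsgn1 : ∀ i, sgn i = 1 ∨ sgn i = -1 := fun i => by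
    simp only [hsgn]; split_ifs <;> simp
  have hsgnsum : ∑ i, sgn i = 0 := by
    have := sum_sign_append (j := j) (fun _ => (1 : ℤ)) (fun _ => 1)
    simp only [Finset.sum_const, Finset.card_univ, Fintype.card_fin, sub_self] at this
    rw [← this]
    refine Finset.sum_congr rfl fun i _ => ?_
    have h1 : Fin.append (fun _ : Fin j => (1 : ℤ)) (fun _ : Fin j => (1 : ℤ)) i = 1 := by
      refine Fin.addCases (fun i => ?_) (fun i => ?_) i
      · simp only [Fin.append_left]
      · simp only [Fin.append_right]
    rw [h1, mul_one]
  set ilast : Fin (j + j) := ⟨j + j - 1, by omega⟩ with hilast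
  have hlast : ∀ i : Fin (j + j), i ≤ ilast := fun i => by
    rw [Fin.le_def]; have := i.isLt; simp only [hilast]; omega
  set D : ℤ := ((A.sup id : ℕ) : ℤ) with hD
  have hD0 : 0 ≤ D := by rw [hD]; exact_mod_cast Nat.zero_le _
  set Aℤ : Finset ℤ := A.image (fun a : ℕ => (a : ℤ)) with hAℤ
  have hAℤcard : #Aℤ = #A := by
    rw [hAℤ, Finset.card_image_of_injective _ Nat.cast_injective]
  have hAdiam : ∀ a ∈ Aℤ, ∀ a' ∈ Aℤ, |a - a'| ≤ D := by
    intro a ha a' ha'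
    rw [hAℤ, Finset.mem_image] at ha ha'
    obtain ⟨b, hb, rfl⟩ := ha
    obtain ⟨b', hb', rfl⟩ := ha'
    have h1 : b ≤ A.sup id := Finset.le_sup (f := id) hb
    have h2 : b' ≤ A.sup id := Finset.le_sup (f := id) hb'
    rw [abs_le, hD]
    constructor <;> omega
  -- constants
  obtain ⟨C₁, X₁, hC₁0, hcorr⟩ := sum_prod_vonMangoldt_le_of_card_image ((j + j) * #A)
  obtain ⟨C₂, hC₂⟩ := card_pinned_balanced_le (j + j) hD0 sgn hsgn1 hsgnsum ilast hlast
  set X₃ : ℕ := ⌈Real.exp (Real.exp 1)⌉₊ with hX₃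
  refine ⟨2 * C₁ * (((j + j) + 1 : ℕ) : ℝ) * C₂ * (4 : ℝ) ^ (2 * j - 2), max X₁ X₃, by positivity, ?_⟩
  intro g hg X hX H hH hlogH hHX
  have hXX₁ : X₁ ≤ X := le_trans (le_max_left _ _) hX
  have hXX₃ : X₃ ≤ X := le_trans (le_max_right _ _) hX
  -- logarithms
  have hee : Real.exp (Real.exp 1) ≤ X := (Nat.le_ceil _).trans (by exact_mod_cast hXX₃)
  have hX0 : (0 : ℝ) < X := lt_of_lt_of_le (Real.exp_pos _) hee
  have hlogX : Real.exp 1 ≤ Real.log X := by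
    rw [← Real.log_exp (Real.exp 1)]; exact Real.log_le_log (Real.exp_pos _) hee
  have hlogX1 : 1 ≤ Real.log X := le_trans (by linarith [Real.add_one_le_exp (1 : ℝ)]) hlogX
  have hllX : 1 ≤ Real.log (Real.log X) := by
    rw [← Real.log_exp 1]; exact Real.log_le_log (Real.exp_pos _) hlogX
  have hH0 : (0 : ℝ) < H := by exact_mod_cast hH
  have h2H : ((2 * H : ℕ) : ℝ) = 2 * H := by push_cast; ring
  -- `(log X)^ℓ ≤ 2H` and `(log X)^{ℓ j} ≤ (2H)^{j-1}`
  have hlogℓ : Real.log X ^ #A ≤ 2 * H := by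
    have h1 : (Real.log X ^ #A) ^ (j - 1) ≤ (2 * H) ^ (j - 1) := by
      calc (Real.log X ^ #A) ^ (j - 1) = Real.log X ^ (#A * (j - 1)) := by rw [← pow_mul]
        _ ≤ Real.log X ^ (#A * j) := pow_le_pow_right₀ hlogX1 (Nat.mul_le_mul_left _ (Nat.sub_le j 1))
        _ ≤ (2 * H) ^ (j - 1) := by rw [← h2H]; exact hlogH
    exact le_of_pow_le_pow_left₀ (by omega) (by positivity) h1
  have hlogℓj : Real.log X ^ (#A * j) ≤ (2 * H) ^ (j - 1) := by rw [← h2H]; exact hlogH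
  -- the weights
  set ΛA : ℕ → ℝ := fun n => ∏ a ∈ A, Λ (n + a) with hΛA
  set v : ℕ → ℝ := fun n => if 2 * H ≤ n ∧ n ≤ X then ΛA n else 0 with hv
  set w : ℕ → ℂ := fun n => if 2 * H ≤ n ∧ n ≤ X then ((∏ a ∈ A, Λ (n + a) : ℝ) : ℂ) * g n
    else 0 with hw
  have hΛA0 : ∀ n, 0 ≤ ΛA n := fun n => Finset.prod_nonneg fun a _ => ArithmeticFunction.vonMangoldt_nonneg
  have hv0 : ∀ n, 0 ≤ v n := fun n => by simp only [hv]; split_ifs; exacts [hΛA0 n, le_rfl]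
  have hvΛ : ∀ n, v n ≤ ΛA n := fun n => by simp only [hv]; split_ifs; exacts [le_rfl, hΛA0 n]
  have hsupp : ∀ n, v n ≠ 0 → 2 * H ≤ n ∧ n ≤ X := fun n hn => by
    simp only [hv] at hn; split_ifs at hn with h; exacts [h, absurd rfl hn]
  have hwv : ∀ n, ‖w n‖ ≤ v n := by
    intro n
    simp only [hw, hv]
    split_ifs with h
    · rw [norm_mul, Complex.norm_real, Real.norm_eq_abs, abs_of_nonneg (hΛA0 n)]
      calc ΛA n * ‖g n‖ ≤ ΛA n * 1 := mul_le_mul_of_nonneg_left (hg n) (hΛA0 n)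
        _ = ΛA n := mul_one _
    · simp
  -- Step 1: window by window, expand the moment
  set L : ℕ := 2 * H with hL
  set K : Finset ℕ := Icc 1 (X + L) with hK
  set Wk : ℕ → Finset ℕ := fun k => Ioc (k - L) k with hWk
  have hcont : ∀ k, Continuous fun α : ℝ =>
      ‖∑ n ∈ Wk k, w n * (𝐞 (-((n : ℝ) * α)) : ℂ)‖ ^ (2 * j) := by
    intro k
    refine ((continuous_finsetSum _ fun n _ => continuous_const.mul ?_).norm).pow _
    have : (fun α : ℝ => (𝐞 (-((n : ℝ) * α)) : ℂ)) = fun α => (𝐞 ((-(n : ℝ)) * α) : ℂ) := by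
      funext α; congr 2; ring
    rw [this]; exact continuous_fourierChar_mul _
  have step1 : ∫ α in (0 : ℝ)..1, ∑ k ∈ K, ‖∑ n ∈ Wk k, w n * (𝐞 (-((n : ℝ) * α)) : ℂ)‖ ^ (2 * j) ≤
      ∑ k ∈ K, ∑ p ∈ ((Fintype.piFinset fun _ : Fin j => Wk k) ×ˢ
          (Fintype.piFinset fun _ : Fin j => Wk k)).filter (fun p => ∑ i, p.1 i = ∑ i, p.2 i),
        (∏ i, v (p.1 i)) * ∏ i, v (p.2 i) := by
    rw [intervalIntegral.integral_finsetSum fun k _ => (hcont k).intervalIntegrable 0 1]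
    exact Finset.sum_le_sum fun k _ => integral_norm_pow_le_sum_balanced (Wk k) w v hwv j
  -- Step 2: to a base point and an offset pattern
  have step2 := sum_windows_le_line X H j hj1 v ΛA hv0 hΛA0 hvΛ hsupp
  set E : Finset ((Fin j → ℕ) × (Fin j → ℕ)) :=
    ((Fintype.piFinset fun _ : Fin j => Icc 1 (4 * H - 1)) ×ˢ
      (Fintype.piFinset fun _ : Fin j => Icc 1 (4 * H - 1))).filter
        (fun e => ∑ i, e.1 i = ∑ i, e.2 i ∧ e.2 ⟨j - 1, by omega⟩ = 2 * H) with hE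
  -- Step 3: the correlation bound for each pattern
  have hmaxA : ∀ a ∈ A, a ≤ A.sup id := fun a ha => Finset.le_sup (f := id) ha
  have step3 : ∀ e ∈ E, ∑ n ∈ range (X + 1), (∏ i, ΛA (n + e.1 i)) * ∏ i, ΛA (n + e.2 i) ≤
      C₁ * X * Real.log (Real.log X) ^ ((j + j) * #A) *
        Real.log X ^ (((j + j) * #A) - #A * #(leaders D (Fin.append (fun i => (e.1 i : ℤ)) (fun i => (e.2 i : ℤ))))) := by
    intro e he
    simp only [hE, Finset.mem_filter, Finset.mem_product, Fintype.mem_piFinset, Finset.mem_Icc] at he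
    obtain ⟨⟨he1, he2⟩, -, -⟩ := he
    set xN : Fin (j + j) → ℕ := Fin.append e.1 e.2 with hxN
    set x : Fin (j + j) → ℤ := Fin.append (fun i => (e.1 i : ℤ)) (fun i => (e.2 i : ℤ)) with hx
    have hxxN : ∀ i, x i = (xN i : ℤ) := by
      intro i
      refine Fin.addCases (fun i => ?_) (fun i => ?_) i
      · simp only [hx, hxN, Fin.append_left]
      · simp only [hx, hxN, Fin.append_right]
    have hxN1 : ∀ i, 1 ≤ xN i ∧ xN i ≤ 4 * H - 1 := by
      intro i
      refine Fin.addCases (fun i => ?_) (fun i => ?_) i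
      · simp only [hxN, Fin.append_left]; exact he1 i
      · simp only [hxN, Fin.append_right]; exact he2 i
    -- the family of shifts
    set y : Fin (j + j) × A → ℕ := fun q => xN q.1 + (q.2 : ℕ) with hy
    have hcard : Fintype.card (Fin (j + j) × A) = ((j + j) * #A) := by
      rw [Fintype.card_prod, Fintype.card_fin, Fintype.card_coe]
    have hy1 : ∀ q, 1 ≤ y q ∧ y q ≤ X := by
      intro q
      have h1 := hxN1 q.1
      have h2 := hmaxA q.2 q.2.2
      simp only [hy]
      constructor <;> omega
    have hprod : ∀ n, (∏ i, ΛA (n + e.1 i)) * ∏ i, ΛA (n + e.2 i) = ∏ q, (Λ (n + y q) : ℝ) := by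
      intro n
      rw [Fintype.prod_prod_type]
      simp only [hy, hxN]
      have happ := prod_append e.1 e.2 (fun t => ∏ a : A, (Λ (n + (t + (a : ℕ))) : ℝ))
      rw [happ]
      simp only [hΛA]
      congr 1 <;> refine Finset.prod_congr rfl fun i _ => ?_ <;> rw [← Finset.prod_coe_sort A] <;>
        refine Finset.prod_congr rfl fun a _ => ?_ <;> rw [add_assoc]
    simp_rw [hprod]
    refine (hcorr X hXX₁ y hcard hy1).trans ?_
    -- compare the number of distinct shifts with the leaders
    have hT : #A * #(leaders D x) ≤ #((univ : Finset (Fin (j + j) × A)).image y) := by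
      have h1 := card_mul_card_leaders_le Aℤ D hAdiam x
      rw [hAℤcard] at h1
      refine h1.trans ?_
      have hsub : (univ ×ˢ Aℤ).image (fun p : Fin (j + j) × ℤ => x p.1 + p.2) ⊆
          ((univ : Finset (Fin (j + j) × A)).image y).image (fun n : ℕ => (n : ℤ)) := by
        intro z hz
        rw [Finset.mem_image] at hz
        obtain ⟨⟨i, a⟩, hia, rfl⟩ := hz
        rw [Finset.mem_product] at hia
        obtain ⟨-, ha⟩ := hia
        rw [hAℤ, Finset.mem_image] at ha
        obtain ⟨b, hb, rfl⟩ := ha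
        rw [Finset.mem_image]
        refine ⟨y (i, ⟨b, hb⟩), Finset.mem_image.2 ⟨(i, ⟨b, hb⟩), Finset.mem_univ _, rfl⟩, ?_⟩
        simp only [hy, hxxN]
        push_cast
        ring
      exact (Finset.card_le_card hsub).trans Finset.card_image_le
    have hexp : ((j + j) * #A) - #((univ : Finset (Fin (j + j) × A)).image y) ≤ ((j + j) * #A) - #A * #(leaders D x) :=
      Nat.sub_le_sub_left hT ((j + j) * #A)
    have hfac : 0 ≤ C₁ * X * Real.log (Real.log X) ^ ((j + j) * #A) := by positivity
    exact mul_le_mul_of_nonneg_left (pow_le_pow_right₀ hlogX1 hexp) hfac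
  -- Step 4: the count of the patterns by the number of leaders
  have step4 : ∑ e ∈ E,
      Real.log X ^ (((j + j) * #A) - #A * #(leaders D (Fin.append (fun i => (e.1 i : ℤ)) (fun i => (e.2 i : ℤ))))) ≤
        (((j + j) + 1 : ℕ) : ℝ) * C₂ * (4 * H : ℝ) ^ (2 * j - 2) := by
    set lead : (Fin j → ℕ) × (Fin j → ℕ) → ℕ := fun e =>
      #(leaders D (Fin.append (fun i => (e.1 i : ℤ)) (fun i => (e.2 i : ℤ)))) with hlead
    have hleadm : ∀ e ∈ E, lead e ∈ range ((j + j) + 1) := by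
      intro e _
      rw [Finset.mem_range, Nat.lt_succ_iff]
      exact (Finset.card_le_univ _).trans (by simp)
    rw [← Finset.sum_fiberwise_of_maps_to hleadm]
    -- each fibre
    have hfib : ∀ c ∈ range ((j + j) + 1),
        ∑ e ∈ E.filter (fun e => lead e = c), Real.log X ^ (((j + j) * #A) - #A * lead e) ≤
          C₂ * (4 * H : ℝ) ^ (2 * j - 2) := by
      intro c hc
      rw [Finset.mem_range, Nat.lt_succ_iff] at hc
      rw [Finset.sum_congr rfl fun e he => by rw [(Finset.mem_filter.1 he).2], Finset.sum_const,
        nsmul_eq_mul]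
      -- the fibre injects into the set counted by `card_pinned_balanced_le`
      have hcardfib : #(E.filter (fun e => lead e = c)) ≤
          C₂ * (4 * H - 1 + 1) ^ (c - 1 - if (j + j) < 2 * c then 1 else 0) := by
        refine le_trans ?_ (hC₂ (4 * H - 1) (2 * H) c)
        refine Finset.card_le_card_of_injOn
          (fun e => Fin.append (fun i => (e.1 i : ℤ)) (fun i => (e.2 i : ℤ))) ?_ ?_
        · intro e he
          have he' := Finset.mem_filter.1 he
          have heE := he'.1
          simp only [hE, Finset.mem_filter, Finset.mem_product, Fintype.mem_piFinset,
            Finset.mem_Icc] at heE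
          obtain ⟨⟨he1, he2⟩, hbal, hpin⟩ := heE
          simp only [Finset.coe_filter, Set.mem_setOf_eq, Fintype.mem_piFinset, Finset.mem_Icc]
          refine ⟨fun i => ?_, ?_, ?_, he'.2⟩
          · refine Fin.addCases (fun i => ?_) (fun i => ?_) i
            · simp only [Fin.append_left]
              have := he1 i
              constructor <;> omega
            · simp only [Fin.append_right]
              have := he2 i
              constructor <;> omega
          · rw [sum_sign_append, sub_eq_zero]
            exact_mod_cast hbal
          · have hil : ilast = Fin.natAdd j ⟨j - 1, by omega⟩ := by
              ext; simp [hilast]; omega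
            rw [hil, Fin.append_right]
            exact_mod_cast hpin
        · intro e₁ _ e₂ _ h
          obtain ⟨h1, h2⟩ := append_cast_injective h
          exact Prod.ext h1 h2
      have h4H : ((4 * H - 1 + 1 : ℕ) : ℝ) = 4 * H := by
        have : 4 * H - 1 + 1 = 4 * H := by omega
        rw [this]; push_cast; ring
      have hcardfib' : (#(E.filter (fun e => lead e = c)) : ℝ) ≤
          C₂ * (4 * H : ℝ) ^ (c - 1 - if (j + j) < 2 * c then 1 else 0) := by
        rw [← h4H]; exact_mod_cast hcardfib
      -- the fibre is empty for `c = 0`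
      rcases Nat.eq_zero_or_pos c with hc0 | hc0
      · have hempty : E.filter (fun e => lead e = c) = ∅ := by
          rw [Finset.filter_eq_empty_iff]
          intro e _ hle
          rw [hc0] at hle
          have hne : ilast ∈ leaders D (Fin.append (fun i => (e.1 i : ℤ)) (fun i => (e.2 i : ℤ))) :=
            mem_leaders_of_forall_le hlast
          rw [hlead] at hle
          simp only at hle
          rw [Finset.card_eq_zero] at hle
          rw [hle] at hne
          exact absurd hne (Finset.notMem_empty _)
        rw [hempty]; simp only [Finset.card_empty, Nat.cast_zero, zero_mul]
        positivity
      · -- the arithmetic: every term is `≤ (4H)^{2j-2}`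
        have h4H1 : (1 : ℝ) ≤ 4 * H := by
          have : (1 : ℝ) ≤ H := by exact_mod_cast hH
          linarith
        have h2H4 : (2 * H : ℝ) ≤ 4 * H := by linarith
        have hkey : Real.log X ^ (((j + j) * #A) - #A * c) * (4 * H : ℝ) ^ (c - 1 - if (j + j) < 2 * c then 1 else 0) ≤
            (4 * H : ℝ) ^ (2 * j - 2) := by
          have hMc : ((j + j) * #A) - #A * c = #A * ((j + j) - c) := by
            refine Nat.sub_eq_of_eq_add ?_
            rw [← Nat.mul_add, Nat.sub_add_cancel hc, Nat.mul_comm]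
          rw [hMc]
          split_ifs with hδ
          · -- `c ≥ j + 1`
            have hcj : j + 1 ≤ c := by omega
            calc Real.log X ^ (#A * ((j + j) - c)) * (4 * H : ℝ) ^ (c - 1 - 1)
                ≤ (2 * H) ^ ((j + j) - c) * (4 * H : ℝ) ^ (c - 1 - 1) := by
                  refine mul_le_mul_of_nonneg_right ?_ (by positivity)
                  rw [pow_mul]; exact pow_le_pow_left₀ (by positivity) hlogℓ _
              _ ≤ (4 * H) ^ ((j + j) - c) * (4 * H : ℝ) ^ (c - 1 - 1) := by
                  refine mul_le_mul_of_nonneg_right (pow_le_pow_left₀ (by positivity) h2H4 _)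
                    (by positivity)
              _ = (4 * H : ℝ) ^ ((j + j) - c + (c - 1 - 1)) := by rw [pow_add]
              _ = (4 * H : ℝ) ^ (2 * j - 2) := by congr 1; omega
          · -- `1 ≤ c ≤ j`
            have hcj : c ≤ j := by omega
            have hsplit : #A * ((j + j) - c) = #A * j + #A * (j - c) := by
              rw [← Nat.mul_add]; congr 1; omega
            calc Real.log X ^ (#A * ((j + j) - c)) * (4 * H : ℝ) ^ (c - 1 - 0)
                = Real.log X ^ (#A * j) * (Real.log X ^ #A) ^ (j - c) * (4 * H : ℝ) ^ (c - 1) := by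
                  rw [hsplit, pow_add, pow_mul (Real.log X) #A (j - c), Nat.sub_zero]
              _ ≤ (2 * H) ^ (j - 1) * (2 * H) ^ (j - c) * (4 * H : ℝ) ^ (c - 1) := by
                  refine mul_le_mul_of_nonneg_right ?_ (by positivity)
                  exact mul_le_mul hlogℓj (pow_le_pow_left₀ (by positivity) hlogℓ _)
                    (by positivity) (by positivity)
              _ ≤ (4 * H) ^ (j - 1) * (4 * H) ^ (j - c) * (4 * H : ℝ) ^ (c - 1) := by
                  refine mul_le_mul_of_nonneg_right ?_ (by positivity)
                  exact mul_le_mul (pow_le_pow_left₀ (by positivity) h2H4 _)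
                    (pow_le_pow_left₀ (by positivity) h2H4 _) (by positivity) (by positivity)
              _ = (4 * H : ℝ) ^ (j - 1 + (j - c) + (c - 1)) := by rw [pow_add, pow_add]
              _ = (4 * H : ℝ) ^ (2 * j - 2) := by congr 1; omega
        calc (#(E.filter (fun e => lead e = c)) : ℝ) * Real.log X ^ (((j + j) * #A) - #A * c)
            ≤ C₂ * (4 * H : ℝ) ^ (c - 1 - if (j + j) < 2 * c then 1 else 0) * Real.log X ^ (((j + j) * #A) - #A * c) :=
              mul_le_mul_of_nonneg_right hcardfib' (by positivity)
          _ = C₂ * (Real.log X ^ (((j + j) * #A) - #A * c) * (4 * H : ℝ) ^ (c - 1 - if (j + j) < 2 * c then 1 else 0)) := by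
              ring
          _ ≤ C₂ * (4 * H : ℝ) ^ (2 * j - 2) := mul_le_mul_of_nonneg_left hkey (Nat.cast_nonneg _)
    calc ∑ c ∈ range ((j + j) + 1), ∑ e ∈ E.filter (fun e => lead e = c), Real.log X ^ (((j + j) * #A) - #A * lead e)
        ≤ ∑ _c ∈ range ((j + j) + 1), C₂ * (4 * H : ℝ) ^ (2 * j - 2) := Finset.sum_le_sum hfib
      _ = (((j + j) + 1 : ℕ) : ℝ) * C₂ * (4 * H : ℝ) ^ (2 * j - 2) := by
          rw [Finset.sum_const, Finset.card_range, nsmul_eq_mul]; push_cast; ring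
  -- assembly
  have hsum3 : ∑ q ∈ (range (X + 1)) ×ˢ E, (∏ i, ΛA (q.1 + q.2.1 i)) * ∏ i, ΛA (q.1 + q.2.2 i) ≤
      C₁ * X * Real.log (Real.log X) ^ ((j + j) * #A) * ((((j + j) + 1 : ℕ) : ℝ) * C₂ * (4 * H : ℝ) ^ (2 * j - 2)) := by
    rw [Finset.sum_product_right]
    calc ∑ e ∈ E, ∑ n ∈ range (X + 1), (∏ i, ΛA (n + e.1 i)) * ∏ i, ΛA (n + e.2 i)
        ≤ ∑ e ∈ E, C₁ * X * Real.log (Real.log X) ^ ((j + j) * #A) *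
            Real.log X ^ (((j + j) * #A) - #A * #(leaders D (Fin.append (fun i => (e.1 i : ℤ)) (fun i => (e.2 i : ℤ))))) :=
          Finset.sum_le_sum step3
      _ = C₁ * X * Real.log (Real.log X) ^ ((j + j) * #A) * ∑ e ∈ E,
            Real.log X ^ (((j + j) * #A) - #A * #(leaders D (Fin.append (fun i => (e.1 i : ℤ)) (fun i => (e.2 i : ℤ))))) := by
          rw [Finset.mul_sum]
      _ ≤ C₁ * X * Real.log (Real.log X) ^ ((j + j) * #A) * ((((j + j) + 1 : ℕ) : ℝ) * C₂ * (4 * H : ℝ) ^ (2 * j - 2)) :=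
          mul_le_mul_of_nonneg_left step4 (by positivity)
  have hpow : (2 * H : ℝ) * (4 * H : ℝ) ^ (2 * j - 2) = 2 * 4 ^ (2 * j - 2) * (H : ℝ) ^ (2 * j - 1) := by
    have : 2 * j - 1 = (2 * j - 2) + 1 := by omega
    rw [this, pow_succ, mul_pow]; ring
  calc ∫ α in (0 : ℝ)..1, ∑ k ∈ K, ‖∑ n ∈ Wk k, w n * (𝐞 (-((n : ℝ) * α)) : ℂ)‖ ^ (2 * j)
      ≤ _ := step1
    _ ≤ _ := step2
    _ ≤ (2 * H : ℝ) * (C₁ * X * Real.log (Real.log X) ^ ((j + j) * #A) *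
          ((((j + j) + 1 : ℕ) : ℝ) * C₂ * (4 * H : ℝ) ^ (2 * j - 2))) :=
        mul_le_mul_of_nonneg_left hsum3 (by positivity)
    _ = 2 * C₁ * (((j + j) + 1 : ℕ) : ℝ) * C₂ * (4 : ℝ) ^ (2 * j - 2) * X *
          Real.log (Real.log X) ^ ((j + j) * #A) * (H : ℝ) ^ (2 * j - 1) := by
        have : (2 * H : ℝ) * (4 * H : ℝ) ^ (2 * j - 2) = 2 * 4 ^ (2 * j - 2) * (H : ℝ) ^ (2 * j - 1) := hpow
        calc (2 * H : ℝ) * (C₁ * X * Real.log (Real.log X) ^ ((j + j) * #A) *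
              ((((j + j) + 1 : ℕ) : ℝ) * C₂ * (4 * H : ℝ) ^ (2 * j - 2)))
            = ((2 * H : ℝ) * (4 * H : ℝ) ^ (2 * j - 2)) * (C₁ * X * Real.log (Real.log X) ^ ((j + j) * #A) *
              ((((j + j) + 1 : ℕ) : ℝ) * C₂)) := by ring
          _ = _ := by rw [this]; ring

end Literature.NumberTheory.Sieve.LichtmanTeravainen2022.Liouville
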